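import Mathlib.Tactic
import Literature.Computability.Complexity.Promise
import Literature.Computability.Complexity.PRGDerandomizationPromise
import Literature.Computability.Complexity.ProbabilisticClassesProofs
import Literature.Computability.Cryptography.ClassBQP
import Literature.Computability.Cryptography.ClassBQPProofs
import Literature.Computability.QuantumComplexity.BQPSubsetPP
import Summits.QuantumAdvantage.QuantumAdvantage.Statement
import Summits.QuantumAdvantage.QuantumAdvantage.Theorems.SoloInformedPseudoDeterministicLift
import Summits.QuantumAdvantage.QuantumAdvantage.Theorems.SoloInformedPromiseLiftPP
import HarnessLib

/-!
# SoloInformedTwoExtremes — `Q-EXT` holds at both extremes of the strength of `BQP`; the classical mirror closes under derandomization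

Solo seat `solo-QuantumAdvantage-informed` (ideation tier, summit-directed). Where the lift hypothesis
`Q-EXT := PromiseBQP ⊆ promiseLift BQP` stands relative to the standard conjectural landscape:

* **weak extreme** (`PromiseBQP ⊆ PromiseP`: quantum promise problems are classically easy):
  `promiseIsLift_of_promiseBQP_subset_promiseP` (`Q-EXT` holds), `BQP_subset_P_of_promiseBQP_subset_promiseP`,
  `not_quantumAdvantage_of_promiseBQP_subset_promiseP` (the summit fails);
* **strong extreme** (`PP ⊆ BQP`): `Q-EXT` holds (`promiseIsLift_of_PP_subset_BQP`, file `SoloInformedPromiseLiftPP`) and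
  **the summit is exactly its own floor**: `quantumAdvantage_iff_not_PP_subset_BPP_of_PP_subset_BQP : PP ⊆ BQP →
  (QuantumAdvantage ↔ ¬ PP ⊆ BPP)`; `promiseIsLift_of_extremes` packages the disjunction;
* **classical mirror.** The classical analogue `C-EXT := PromiseBPP' ⊆ promiseLift BPP` (every textbook promise-`BPP`
  problem is solved by a `BPP` LANGUAGE) follows from promise derandomization `PromiseBPP' ⊆ PromiseP`
  (`classicalIsLift_of_promiseBPP'_subset_promiseP`), hence from the Impagliazzo–Wigderson hardness hypothesis via the
  tree's `PromiseBPP'_subset_PromiseP_of_avgHard_E` (`classicalIsLift_of_avgHard_E`). So classically the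
  language/promise gap closes under a mainstream HARDNESS assumption, whereas for `BQP` the only known sufficient
  conditions for `Q-EXT` are the two extremes above — in the mainstream middle (summit true, `PP ⊄ BQP`) no standard
  conjecture is known to decide `Q-EXT` either way.

[cite: Goldreich2006, Def. 1.2 and §1.2] [cite: AroraBarakCC2009, Lemma 20.3 and Cor. 20.4] [cite: Watrous2009, §III.2]
[cite: BernsteinVazirani1997, §8 (BQP ⊆ P^{#P} ⊆ PSPACE)] [cite: AdlemanDeMarraisHuang1997, Thm. (BQP ⊆ PP)]
-/

noncomputable section

namespace Summit.QuantumAdvantage.QuantumAdvantage.Theorems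

open _root_.Computability Literature.Computability.Complexity Literature.Computability.Cryptography
  Literature.Computability.QuantumComplexity Filter

/-! ### The weak extreme: `PromiseBQP ⊆ PromiseP` -/

/-- **`PromiseBQP ⊆ PromiseP ⇒ Q-EXT`** (`PromiseP = promiseLift P` and `P ⊆ BQP`). [cite: Goldreich2006, Def. 1.2] -/
theorem promiseIsLift_of_promiseBQP_subset_promiseP (h : PromiseBQP ⊆ PromiseP) :
    PromiseBQP ⊆ promiseLift BQP := fun _ hQ =>
  promiseLift_mono P_subset_BQP_holds (h hQ)

/-- **`PromiseBQP ⊆ PromiseP ⇒ BQP ⊆ P`**: the trivial-promise problem of `L ∈ BQP` is then solved by some `L' ∈ P`,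
and a language solving `⟨L, Lᶜ⟩` is `L` itself. [cite: Goldreich2006, §1.1 and Def. 1.2] -/
theorem BQP_subset_P_of_promiseBQP_subset_promiseP (h : PromiseBQP ⊆ PromiseP) : BQP ⊆ Classes.P := by
  intro L hL
  obtain ⟨L', hL', hyes, hno⟩ := h (ofLanguage_mem_PromiseBQP_iff.2 hL)
  have hLL' : L = L' :=
    Set.ext fun x => ⟨fun hx => hyes hx, fun hx => by_contra fun hx' => hno hx' hx⟩
  rw [hLL']
  exact hL'

/-- **At the weak extreme the summit fails**: `PromiseBQP ⊆ PromiseP ⇒ BQP ⊆ P ⊆ BPP ⇒ ¬QuantumAdvantage`.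
[cite: Goldreich2006, Def. 1.2] [cite: AroraBarakCC2009, §7.1 (P ⊆ BPP)] -/
theorem not_quantumAdvantage_of_promiseBQP_subset_promiseP (h : PromiseBQP ⊆ PromiseP) : ¬ QuantumAdvantage :=
  fun ⟨_, hL, hLB⟩ => hLB (P_subset_BPP_holds (BQP_subset_P_of_promiseBQP_subset_promiseP h hL))

/-- The weak extreme packaged: `Q-EXT ∧ ¬summit`. [cite: Goldreich2006, Def. 1.2] -/
theorem promiseIsLift_and_not_quantumAdvantage_of_promiseBQP_subset_promiseP (h : PromiseBQP ⊆ PromiseP) :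
    PromiseBQP ⊆ promiseLift BQP ∧ ¬ QuantumAdvantage :=
  ⟨promiseIsLift_of_promiseBQP_subset_promiseP h, not_quantumAdvantage_of_promiseBQP_subset_promiseP h⟩

/-! ### The strong extreme: `PP ⊆ BQP` -/

/-- **At the strong extreme the summit is exactly its floor**: if `PP ⊆ BQP` then
`QuantumAdvantage ↔ ¬(PP ⊆ BPP)` (`⇒` by `BQP ⊆ PP`, the tree's `BQP_subset_PP_holds`; `⇐`: a `PP` language outside
`BPP` is a `BQP` language outside `BPP`). [cite: AdlemanDeMarraisHuang1997, Thm. (BQP ⊆ PP)]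
[cite: BernsteinVazirani1997, §8] -/
theorem quantumAdvantage_iff_not_PP_subset_BPP_of_PP_subset_BQP (h : PP ⊆ BQP) :
    QuantumAdvantage ↔ ¬ PP ⊆ BPP := by
  constructor
  · rintro ⟨L, hL, hLB⟩ hPB
    exact hLB (hPB (BQP_subset_PP_holds hL))
  · intro hn
    by_contra hqa
    refine hn fun L hL => ?_
    by_contra hLB
    exact hqa ⟨L, h hL, hLB⟩

/-- The strong extreme packaged: `PP ⊆ BQP ⇒ Q-EXT ∧ (QuantumAdvantage ↔ PP ⊄ BPP)`.
[cite: AdlemanDeMarraisHuang1997, Thm. (BQP ⊆ PP)] [cite: Goldreich2006, Def. 1.2] -/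
theorem promiseIsLift_and_iff_floor_of_PP_subset_BQP (h : PP ⊆ BQP) :
    PromiseBQP ⊆ promiseLift BQP ∧ (QuantumAdvantage ↔ ¬ PP ⊆ BPP) :=
  ⟨promiseIsLift_of_PP_subset_BQP h, quantumAdvantage_iff_not_PP_subset_BPP_of_PP_subset_BQP h⟩

/-- **`Q-EXT` at both extremes**: `PromiseBQP ⊆ PromiseP ∨ PP ⊆ BQP ⇒ Q-EXT`. [cite: Goldreich2006, Def. 1.2] -/
theorem promiseIsLift_of_extremes (h : PromiseBQP ⊆ PromiseP ∨ PP ⊆ BQP) : PromiseBQP ⊆ promiseLift BQP :=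
  h.elim promiseIsLift_of_promiseBQP_subset_promiseP promiseIsLift_of_PP_subset_BQP

/-! ### The classical mirror: `C-EXT` from derandomization -/

/-- **Promise derandomization closes the classical language/promise gap**: `PromiseBPP' ⊆ PromiseP ⇒
PromiseBPP' ⊆ promiseLift BPP` (`C-EXT`), since `PromiseP = promiseLift P` and `P ⊆ BPP`.
[cite: Goldreich2006, Def. 1.2 and §1.2] [cite: AroraBarakCC2009, §7.1] -/
theorem classicalIsLift_of_promiseBPP'_subset_promiseP (h : PromiseBPP' ⊆ PromiseP) :
    PromiseBPP' ⊆ promiseLift BPP := fun _ hQ =>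
  promiseLift_mono P_subset_BPP_holds (h hQ)

/-- **`C-EXT` from the Impagliazzo–Wigderson hypothesis**: a language in `E` of average-case circuit hardness
`2^{εn}` gives `PromiseBPP' ⊆ PromiseP` (tree: `PromiseBPP'_subset_PromiseP_of_avgHard_E`, Arora–Barak Lemma 20.3 /
Cor. 20.4 in promise form), hence `C-EXT`. The quantum class has no analogous hardness-based source for `Q-EXT`.
[cite: AroraBarakCC2009, Lemma 20.3 and Cor. 20.4] [cite: Goldreich2006, Def. 1.2] -/
theorem classicalIsLift_of_avgHard_E {L : Language Bool} (hL : L ∈ E) {ε : ℝ} (hε : 0 < ε)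
    (hhard : ∀ᶠ n in atTop,
      Literature.Computability.MetaComplexity.AvgHardAtLeast (L.sliceFn n) ((2 : ℝ) ^ (ε * n))) :
    PromiseBPP' ⊆ promiseLift BPP :=
  classicalIsLift_of_promiseBPP'_subset_promiseP (PromiseBPP'_subset_PromiseP_of_avgHard_E hL hε hhard)

end Summit.QuantumAdvantage.QuantumAdvantage.Theorems

end
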